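import Mathlib
import Summits.ValiantsHypothesis.ValiantsHypothesis.Theorems.NewtonUnitEquationsDissociatedUniformProductChart
import Summits.ValiantsHypothesis.ValiantsHypothesis.Theorems.NewtonUnitEquationsDissociatedUniformQuasiPoly
import Summits.ValiantsHypothesis.ValiantsHypothesis.Theorems.NewtonUnitEquationsNewtonTauWeakAutomatonStep

/-!
# `NewtonUnitEquationsNewtonTauWeakAutomatonAnisoStep` — mixed-radix carry automaton: the shadow recursion

Rung toward `stub_binomialNewtonTauCommon` (crux `NewtonTauWeak`, stmt-ValiantsHypothesis-5904), line
`binomial-normal-form`, THEOREM C (mixed radix): registered stub `stub_anisoStep`, the verbatim generalisation of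
`stub_autoStep` (`…AutomatonStep.lean`, the case `sx = sy = 2^h`, `Hx = Hy = 2^m`) to an ANISOTROPIC scaling.

Setting.  On the box `E = [0, sx·Hx) × [0, sy·Hy)` the vector configuration `x : E → ℂ^d` is a LINEAR image `π` of
the Kronecker product of the "high" configuration `x₁` on `E₁ = [0, Hx) × [0, Hy)` and the "low" configuration `x₂`
on `E₂ = [0, sx) × [0, sy)`, positions corresponding under the position bijection
`(H, L) ↦ (sx H₁ + L₁, sy H₂ + L₂)`, `E₁ × E₂ → E` (hypothesis `hx`).

Claim `stub_anisoStep`: the configuration shadows (`QuasiPoly.cshadow`, Theorem Q, file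
`…DissociatedUniformGreedyCharts.lean`) satisfy `s(E, x) ≤ 2D²(D s(E₁, x₁) + D s(E₂, x₂) + 1) + 2D + 1`, `D = d²`.

Proof.  As in `stub_autoStep`: the Kronecker product is the Hadamard product of the lifts `z₁ H = x₁ H ⊗ 𝟙`,
`z₂ L = 𝟙 ⊗ x₂ L` in `ℂ^{d·d}`; Theorem Q's product step `QuasiPoly.ncard_cshadow_prod_le` bounds the shadow of the
product configuration `(E₁ ×ˢ E₂, z₁ ⊗ z₂)` with ADDED coordinates, the coordinates of the high factor rescaled
anisotropically by `(X, Y) ↦ (sx X, sy Y)` (so that the coordinates of `(H, L)` are those of its position); greedy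
sets pull back along linear maps of the vectors (`AutoStepAux.gE_pull`), so the shadow of `(E, x)` embeds, via the
inverse position map (`Nat.div_add_mod`, `0 < sx`, `0 < sy`), into the product shadow, and the factor shadows of the
lifts are contained in those of `x₁`, `x₂`.  THE ONE NEW INGREDIENT (`AnisoStepAux.cshadow_aniso_subset`): an
anisotropic rescaling `(X, Y) ↦ (a X, b Y)` of the coordinates does not enlarge the configuration shadow, because the
height in direction `w` for the rescaled coordinates IS the height in direction `(a w₀, b w₁)` for the original ones
(`lin (a•X) (b•Y) w = lin X Y ![a w₀, b w₁]`), so injectivity and greediness transfer verbatim.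
[folklore: greedy bases of a matroid]
-/

set_option linter.dupNamespace false

noncomputable section

open scoped BigOperators
open Summit.ValiantsHypothesis.ValiantsHypothesis.Theorems.NewtonUnitEquationsDissociatedUniform.QuasiPoly
  (cshadow gE lin cshadow_finite ncard_cshadow_prod_le)

namespace Summit.ValiantsHypothesis.ValiantsHypothesis.Theorems.NewtonTauWeakAutomaton

namespace AnisoStepAux

/-- **Anisotropic rescaling of the coordinates does not enlarge the configuration shadow.**  The planar height in
direction `w` for the coordinates `(a X, b Y)` is the planar height in direction `(a w₀, b w₁)` for `(X, Y)`, so an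
injective direction with `e` greedy for the rescaled coordinates yields one for the original coordinates. [folklore] -/
theorem cshadow_aniso_subset {α : Type} {k : ℕ} (E : Finset α) (z : α → Fin k → ℂ) (X Y : α → ℝ) (a b : ℝ) :
    cshadow E z (fun e => a * X e) (fun e => b * Y e) ⊆ cshadow E z X Y := by
  rintro e ⟨w, hinj, he⟩
  have hfun : lin (fun e => a * X e) (fun e => b * Y e) w = lin X Y ![w 0 * a, w 1 * b] := by
    funext e'
    simp only [lin, Matrix.cons_val_zero, Matrix.cons_val_one]
    ring
  rw [hfun] at hinj he
  exact ⟨_, hinj, he⟩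

end AnisoStepAux

open AutoStepAux AnisoStepAux

/-- **The mixed-radix carry-automaton step (shadow recursion with anisotropic scaling).**  If the configuration `x`
on the box `E = [0, sx·Hx) × [0, sy·Hy)` is a linear image `π` of the Kronecker product of the configurations `x₁` on
`E₁ = [0, Hx) × [0, Hy)` and `x₂` on `E₂ = [0, sx) × [0, sy)` along the position bijection
`(H, L) ↦ (sx H₁ + L₁, sy H₂ + L₂)` (`1 ≤ sx`, `1 ≤ sy`), then the configuration shadows satisfy
`s(E, x) ≤ 2D²(D s(E₁, x₁) + D s(E₂, x₂) + 1) + 2D + 1` with `D = d²` (Theorem Q's product step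
`QuasiPoly.ncard_cshadow_prod_le` for the Hadamard realisation of the Kronecker product in `ℂ^{d·d}`, the high factor's
coordinates rescaled by `(X, Y) ↦ (sx X, sy Y)`, which does not enlarge its shadow: `cshadow_aniso_subset`).
[folklore] -/
theorem stub_anisoStep {d : ℕ} (sx sy Hx Hy : ℕ) (hsx : 1 ≤ sx) (hsy : 1 ≤ sy) (E E₁ E₂ : Finset (ℕ × ℕ))
    (hE : E = Finset.range (sx * Hx) ×ˢ Finset.range (sy * Hy))
    (hE₁ : E₁ = Finset.range Hx ×ˢ Finset.range Hy)
    (hE₂ : E₂ = Finset.range sx ×ˢ Finset.range sy)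
    (x x₁ x₂ : ℕ × ℕ → Fin d → ℂ) (π : (Fin (d * d) → ℂ) →ₗ[ℂ] (Fin d → ℂ))
    (hx : ∀ H ∈ E₁, ∀ L ∈ E₂, x (sx * H.1 + L.1, sy * H.2 + L.2) =
      π (fun ij => x₁ H (finProdFinEquiv.symm ij).1 * x₂ L (finProdFinEquiv.symm ij).2)) :
    (Summit.ValiantsHypothesis.ValiantsHypothesis.Theorems.NewtonUnitEquationsDissociatedUniform.QuasiPoly.cshadow
        E x (fun P => ((P.1 : ℕ) : ℝ)) (fun P => ((P.2 : ℕ) : ℝ))).ncard ≤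
      2 * (d * d * (d * d) * (d * d *
          (Summit.ValiantsHypothesis.ValiantsHypothesis.Theorems.NewtonUnitEquationsDissociatedUniform.QuasiPoly.cshadow
            E₁ x₁ (fun P => ((P.1 : ℕ) : ℝ)) (fun P => ((P.2 : ℕ) : ℝ))).ncard +
        d * d *
          (Summit.ValiantsHypothesis.ValiantsHypothesis.Theorems.NewtonUnitEquationsDissociatedUniform.QuasiPoly.cshadow
            E₂ x₂ (fun P => ((P.1 : ℕ) : ℝ)) (fun P => ((P.2 : ℕ) : ℝ))).ncard + 1)) +
        d * d + d * d + 1 := by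
  -- notation: planar coordinates, the scales `a = sx`, `b = sy`, the lifts `z₁ = x₁ ⊗ 𝟙`, `z₂ = 𝟙 ⊗ x₂`
  set X : ℕ × ℕ → ℝ := fun P => ((P.1 : ℕ) : ℝ) with hXdef
  set Y : ℕ × ℕ → ℝ := fun P => ((P.2 : ℕ) : ℝ) with hYdef
  set a : ℝ := (sx : ℝ) with hadef
  set b : ℝ := (sy : ℝ) with hbdef
  set z₁ : ℕ × ℕ → Fin (d * d) → ℂ := fun H ij => x₁ H (finProdFinEquiv.symm ij).1 with hz₁
  set z₂ : ℕ × ℕ → Fin (d * d) → ℂ := fun L ij => x₂ L (finProdFinEquiv.symm ij).2 with hz₂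
  have hxpos : 0 < sx := hsx
  have hypos : 0 < sy := hsy
  -- membership in the three boxes
  have hmemE : ∀ P : ℕ × ℕ, P ∈ E ↔ P.1 < sx * Hx ∧ P.2 < sy * Hy := by
    intro P; rw [hE, Finset.mem_product, Finset.mem_range, Finset.mem_range]
  have hmemE₁ : ∀ P : ℕ × ℕ, P ∈ E₁ ↔ P.1 < Hx ∧ P.2 < Hy := by
    intro P; rw [hE₁, Finset.mem_product, Finset.mem_range, Finset.mem_range]
  have hmemE₂ : ∀ P : ℕ × ℕ, P ∈ E₂ ↔ P.1 < sx ∧ P.2 < sy := by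
    intro P; rw [hE₂, Finset.mem_product, Finset.mem_range, Finset.mem_range]
  -- the position bijection `ψ (H, L) = (sx H₁ + L₁, sy H₂ + L₂)` and its inverse `φ`
  set ψ : (ℕ × ℕ) × (ℕ × ℕ) → ℕ × ℕ := fun p => (sx * p.1.1 + p.2.1, sy * p.1.2 + p.2.2) with hψ
  set φ : ℕ × ℕ → (ℕ × ℕ) × (ℕ × ℕ) :=
    fun P => ((P.1 / sx, P.2 / sy), (P.1 % sx, P.2 % sy)) with hφ
  have hψφ : ∀ P, ψ (φ P) = P := fun P =>
    Prod.ext (Nat.div_add_mod P.1 sx) (Nat.div_add_mod P.2 sy)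
  have hφψ : ∀ p : (ℕ × ℕ) × (ℕ × ℕ), p.2.1 < sx → p.2.2 < sy → φ (ψ p) = p := by
    rintro ⟨⟨H₁, H₂⟩, ⟨u, v⟩⟩ hu hv
    simp only [hφ, hψ, Nat.mul_add_div hxpos, Nat.mul_add_div hypos, Nat.div_eq_of_lt hu, Nat.div_eq_of_lt hv,
      add_zero, Nat.mul_add_mod, Nat.mod_eq_of_lt hu, Nat.mod_eq_of_lt hv]
  have hψE : ∀ p ∈ E₁ ×ˢ E₂, ψ p ∈ E := by
    intro p hp
    obtain ⟨h1, h2⟩ := Finset.mem_product.mp hp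
    obtain ⟨hH₁, hH₂⟩ := (hmemE₁ _).mp h1
    obtain ⟨hu, hv⟩ := (hmemE₂ _).mp h2
    rw [hmemE]
    constructor
    · calc sx * p.1.1 + p.2.1 < sx * p.1.1 + sx := by omega
        _ = sx * (p.1.1 + 1) := by ring
        _ ≤ sx * Hx := Nat.mul_le_mul_left _ hH₁
    · calc sy * p.1.2 + p.2.2 < sy * p.1.2 + sy := by omega
        _ = sy * (p.1.2 + 1) := by ring
        _ ≤ sy * Hy := Nat.mul_le_mul_left _ hH₂
  have hφE : ∀ P ∈ E, φ P ∈ E₁ ×ˢ E₂ := by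
    intro P hP
    obtain ⟨h1, h2⟩ := (hmemE P).mp hP
    rw [mul_comm] at h1 h2
    exact Finset.mem_product.mpr ⟨(hmemE₁ _).mpr ⟨(Nat.div_lt_iff_lt_mul hxpos).mpr h1,
      (Nat.div_lt_iff_lt_mul hypos).mpr h2⟩, (hmemE₂ _).mpr ⟨Nat.mod_lt _ hxpos, Nat.mod_lt _ hypos⟩⟩
  -- heights: the (anisotropically rescaled, added) coordinates of `(H, L)` are the coordinates of `ψ (H, L)`
  have hlinψ : ∀ (w : Fin 2 → ℝ) (p : (ℕ × ℕ) × (ℕ × ℕ)),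
      lin (fun p : (ℕ × ℕ) × (ℕ × ℕ) => a * X p.1 + X p.2) (fun p => b * Y p.1 + Y p.2) w p =
        lin X Y w (ψ p) := by
    intro w p
    simp only [lin, hXdef, hYdef, hψ, hadef, hbdef]
    push_cast
    ring
  -- vectors: `x ∘ ψ = π ∘ (z₁ * z₂)` on `E₁ ×ˢ E₂` (Kronecker = Hadamard of the lifts)
  have hxψ : ∀ p ∈ E₁ ×ˢ E₂, x (ψ p) = π (z₁ p.1 * z₂ p.2) := by
    intro p hp
    obtain ⟨h1, h2⟩ := Finset.mem_product.mp hp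
    exact hx p.1 h1 p.2 h2
  -- (a) the shadow of `(E, x)` embeds into the product shadow
  have hA : cshadow E x X Y ⊆ ψ '' cshadow (E₁ ×ˢ E₂) (fun p : (ℕ × ℕ) × (ℕ × ℕ) => z₁ p.1 * z₂ p.2)
      (fun p => a * X p.1 + X p.2) (fun p => b * Y p.1 + Y p.2) := by
    rintro P ⟨w, hinj, hP⟩
    refine ⟨φ P, ⟨w, ?_, ?_⟩, hψφ P⟩
    · intro q hq q' hq' hqq'
      rw [hlinψ, hlinψ] at hqq'
      have heq := hinj (hψE q hq) (hψE q' hq') hqq'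
      obtain ⟨hu, hv⟩ := (hmemE₂ _).mp (Finset.mem_product.mp hq).2
      obtain ⟨hu', hv'⟩ := (hmemE₂ _).mp (Finset.mem_product.mp hq').2
      rw [← hφψ q hu hv, ← hφψ q' hu' hv', heq]
    · exact gE_pull (E₁ ×ˢ E₂) E _ x _ (lin X Y w) π ψ hψE hxψ (fun p _ => (hlinψ w p).symm) (hφE P hP.1)
        (by rw [hψφ]; exact hP)
  have hA' : (cshadow E x X Y).ncard ≤ (cshadow (E₁ ×ˢ E₂) (fun p : (ℕ × ℕ) × (ℕ × ℕ) => z₁ p.1 * z₂ p.2)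
      (fun p => a * X p.1 + X p.2) (fun p => b * Y p.1 + Y p.2)).ncard :=
    (Set.ncard_le_ncard hA ((cshadow_finite _ _ _ _).image ψ)).trans
      (Set.ncard_image_le (cshadow_finite _ _ _ _))
  -- (b) the factor shadows of the lifts are contained in the factor shadows of `x₁`, `x₂`
  have hB : cshadow E₁ z₁ (fun P => a * X P) (fun P => b * Y P) ⊆ cshadow E₁ x₁ X Y :=
    (cshadow_aniso_subset E₁ z₁ X Y a b).trans
      (cshadow_subset_of_linear E₁ x₁ z₁ X Y
        (LinearMap.funLeft ℂ ℂ fun ij : Fin (d * d) => (finProdFinEquiv.symm ij).1) fun _ _ => rfl)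
  have hC : cshadow E₂ z₂ X Y ⊆ cshadow E₂ x₂ X Y :=
    cshadow_subset_of_linear E₂ x₂ z₂ X Y
      (LinearMap.funLeft ℂ ℂ fun ij : Fin (d * d) => (finProdFinEquiv.symm ij).2) fun _ _ => rfl
  have hB' := Set.ncard_le_ncard hB (cshadow_finite _ _ _ _)
  have hC' := Set.ncard_le_ncard hC (cshadow_finite _ _ _ _)
  -- the product step
  have hprod := ncard_cshadow_prod_le E₁ E₂ z₁ z₂ (fun P => a * X P) (fun P => b * Y P) X Y
  refine hA'.trans (hprod.trans ?_)
  gcongr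

end Summit.ValiantsHypothesis.ValiantsHypothesis.Theorems.NewtonTauWeakAutomaton

end
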